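import Summits.CriticalPhenomena.PercolationContinuityZ3.Theses.PercNearOneGluing
import Literature.Probability.Percolation.PercolationEvents
import HarnessLib.Audit
import Summits.CriticalPhenomena.PercolationContinuityZ3.Theorems.PercNearOneGluingNearOneGluingVariants2415

/-! TTRL-lite variant V2438 of stmt-CriticalPhenomena-4574

(`stub_shorteningStep` of line `kn_shortening_induction`, move `specialise+small_case`:
`n := 4` and `A.card = 2`).  This variant is a specialisation of the already-landed sibling
variant V2415 (`A.card ≤ 2` for every `n`, `stub_shorteningStep_var2415`, Kozma–Nitzan's
shortening step for at most two relays, proved outright): instantiate `n := 4` and weaken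
`A.card = 2` to `A.card ≤ 2`.  The displayed induction hypothesis is passed through (unused by
V2415).  No new definitions, no named facts. -/

namespace Summit.CriticalPhenomena.PercolationContinuityZ3.Theorems

open MeasureTheory Set Literature.Probability.LatticeModels Literature.Probability.Percolation
open scoped Classical BigOperators

/-- TTRL-lite variant V2438 of `stub_shorteningStep` (stmt-CriticalPhenomena-4574, Kozma–Nitzan
Conjecture 6 of arXiv:2401.12397 with the induction hypothesis displayed): the shortening step on
four vertices with exactly two relays (`n = 4`, `A.card = 2`), a direct instance of the
`A.card ≤ 2` case `stub_shorteningStep_var2415`. -/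
theorem stub_shorteningStep_var2438 : ∀ (w : Sym2 (Fin 4) → unitInterval) (A : Finset (Fin 4)) (b v x a₀ : Fin 4), A.card = 2 → v ∉ A → v ≠ x → w s(v, x) = 0 → a₀ ∈ A → (∀ a ∈ A, (prodBernoulli w).real (openConn a₀ b) ≤ (prodBernoulli w).real (openConn a b)) → (∀ w' : Sym2 (Fin 4) → unitInterval, (∀ e, w e = 0 → w' e = 0) → ∀ (A' : Finset (Fin 4)) (o' b' : Fin 4) (t : ℝ), (∀ a ∈ A', t ≤ (prodBernoulli w').real (openConn a b')) → (prodBernoulli w').real (⋃ a ∈ A', openConn o' a) * t ≤ (prodBernoulli w').real (openConn o' b')) → (prodBernoulli (Function.update w s(v, x) 1)).real (⋃ a ∈ A, openConn v a) * (prodBernoulli (Function.update w s(v, x) 1)).real (openConn a₀ b) ≤ (prodBernoulli (Function.update w s(v, x) 1)).real (openConn v b) := by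
  intro w A b v x a₀ hA
  exact stub_shorteningStep_var2415 4 w A b v x a₀ hA.le

end Summit.CriticalPhenomena.PercolationContinuityZ3.Theorems
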